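import Literature.Analysis.FluidPDE.TaoY6ChainGeometry
import Literature.Analysis.FluidPDE.PoincareBall
import Literature.Analysis.FluidPDE.TaoY6BallEstimate
import HarnessLib

/-!
# Tao (2011/2013), proof of Thm. 10.1, the term `Y₆`: local root-mean-square vorticities and the
# Poincaré comparison along the radial chains

Analysis/FluidPDE support file for the discharge of the nonlinear estimate `Y₆` of Tao 2011, §10
(arXiv:1108.1165, proof of Thm. 10.1, pp. 32–33). Tao's averages
"`wᵢ := (|3Bᵢ|⁻¹∫_{3Bᵢ}|ω|²)^{1/2}`", his bound (10.23) "`wᵢ ≲ c^{0.05}δ⁻¹W^{1/2}rᵢ⁻²`" and the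
Poincaré comparison (10.22) "`|wᵢ - wⱼ| ≲ (rᵢ⁻¹∫_{10Bᵢ}|∇ω|²)^{1/2}` whenever `Bᵢ, Bⱼ` intersect.
(Indeed, the Poincaré inequality implies that both terms in the left-hand side are within
`O((rᵢ⁻¹∫_{10Bᵢ}|∇ω|²)^{1/2})` of `|(|10Bᵢ|)⁻¹∫_{10Bᵢ} ω|`.)" are recorded, for the continuous
Whitney family of `TaoWhitneyKernel` and the radial parent move of `TaoY6ChainGeometry`, in the
extended nonnegative reals (no integrability bookkeeping, no subtraction):

* `rmsE ω y ρ = ρ^{-3/2} ‖ω‖_{L²(B(y,3ρ))}` (`= √(27|B(0,1)|)·wᵢ`) and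
  `dissE ω y ρ = ρ⁻¹ ∫_{B(y,10ρ)} ‖Dω‖²`;
* `rmsE_le_rmsE_parent_add` — **the one-sided Poincaré increment**: if `ρ_z = λρ` and
  `|z - y| = 3ρ` (a parent move, so `B(z,3ρ_z) ⊆ B(y,10ρ)`), then
  `rmsE ω y ρ ≤ rmsE ω z ρ_z + 114 (dissE ω y ρ)^{1/2}` (both averages are within
  `ρ^{-3/2}‖ω - ⨍_{B(y,10ρ)}ω‖_{L²(B(y,10ρ))} ≤ ρ^{-3/2}(3200ρ²∫_{B(y,10ρ)}‖Dω‖²)^{1/2}` of the same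
  multiple of the mean, by `PoincareBall.lintegral_ball_sub_average_sq_le`; `2√3200 ≤ 114`);
* `rmsE_whitney_le` — **(10.23)**: on the open annulus,
  `rmsE ω y ρ(y) ≤ √(2W/(97k)) ρ(y)⁻²` (`TaoWhitneyKernel.setIntegral_curl_sq_whitneyBall_le`);
* measurability in the centre of integrals over the moving balls `B(y, cρ(y))`.

## References

* T. Tao, arXiv:1108.1165 (`Tao2011`), §10, proof of Thm. 10.1 (pp. 32–33, (10.22)–(10.23)).
-/

noncomputable section

open MeasureTheory Set Function Filter Metric Topology
open scoped ENNReal NNReal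

namespace Literature.Analysis.FluidPDE

/-- Local notation for physical space `ℝ³ = EuclideanSpace ℝ (Fin 3)`. -/
local notation "ℝ³" => EuclideanSpace ℝ (Fin 3)

/-! ### The local quantities -/

section Defs

/-- **The scaled local `L²` vorticity** `rmsE ω y ρ = ρ^{-3/2} ‖ω‖_{L²(B(y,3ρ))}` (Tao's
`wᵢ = (|3Bᵢ|⁻¹∫_{3Bᵢ}|ω|²)^{1/2}` up to the absolute factor `√(27|B(0,1)|)`), in `ℝ≥0∞`. [cite: Tao2011, §10, proof of Thm. 10.1 (p. 32, the averages wᵢ)] -/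
def rmsE (ω : ℝ³ → ℝ³) (y : ℝ³) (ρ : ℝ) : ℝ≥0∞ :=
  ENNReal.ofReal (ρ⁻¹ ^ 3) ^ (1 / 2 : ℝ) * eLpNorm ω 2 (volume.restrict (ball y (3 * ρ)))

/-- **The scaled local dissipation** `dissE ω y ρ = ρ⁻¹ ∫_{B(y,10ρ)} ‖Dω‖²` (operator norm; the
quantity `rᵢ⁻¹∫_{10Bᵢ}|∇ω|²` of (10.22)), in `ℝ≥0∞`. [cite: Tao2011, §10, proof of Thm. 10.1 ((10.22))] -/
def dissE (ω : ℝ³ → ℝ³) (y : ℝ³) (ρ : ℝ) : ℝ≥0∞ :=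
  ENNReal.ofReal ρ⁻¹ * ∫⁻ z in ball y (10 * ρ), ‖fderiv ℝ ω z‖ₑ ^ 2

/-- Unfolding `rmsE`. [folklore] -/
theorem rmsE_def (ω : ℝ³ → ℝ³) (y : ℝ³) (ρ : ℝ) :
    rmsE ω y ρ = ENNReal.ofReal (ρ⁻¹ ^ 3) ^ (1 / 2 : ℝ) * eLpNorm ω 2 (volume.restrict (ball y (3 * ρ))) :=
  rfl

/-- Unfolding `dissE`. [folklore] -/
theorem dissE_def (ω : ℝ³ → ℝ³) (y : ℝ³) (ρ : ℝ) :
    dissE ω y ρ = ENNReal.ofReal ρ⁻¹ * ∫⁻ z in ball y (10 * ρ), ‖fderiv ℝ ω z‖ₑ ^ 2 := rfl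

/-- `rmsE² = ρ⁻³ ∫_{B(y,3ρ)} ‖ω‖²`. [folklore] -/
theorem rmsE_sq (ω : ℝ³ → ℝ³) (y : ℝ³) (ρ : ℝ) :
    rmsE ω y ρ ^ 2 = ENNReal.ofReal (ρ⁻¹ ^ 3) * ∫⁻ z in ball y (3 * ρ), ‖ω z‖ₑ ^ 2 := by
  rw [rmsE_def, mul_pow, ← ENNReal.rpow_two, ← ENNReal.rpow_mul, eLpNorm_two_sq_eq_lintegral]
  norm_num

end Defs

/-! ### Small `ℝ≥0∞` algebra -/

section Algebra

/-- `(x²)^{1/2} = x` in `ℝ≥0∞`. [folklore] -/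
theorem y6_sq_rpow_half (x : ℝ≥0∞) : (x ^ 2) ^ (1 / 2 : ℝ) = x := by
  rw [← ENNReal.rpow_two, ← ENNReal.rpow_mul]; norm_num

/-- `x ≤ (y)^{1/2}` from `x² ≤ y`. [folklore] -/
theorem y6_le_rpow_half_of_sq_le {x y : ℝ≥0∞} (h : x ^ 2 ≤ y) : x ≤ y ^ (1 / 2 : ℝ) := by
  calc x = (x ^ 2) ^ (1 / 2 : ℝ) := (y6_sq_rpow_half x).symm
    _ ≤ y ^ (1 / 2 : ℝ) := ENNReal.rpow_le_rpow h (by norm_num)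

/-- `(ab)^{1/2} = a^{1/2} b^{1/2}`. [folklore] -/
theorem y6_mul_rpow_half (a b : ℝ≥0∞) : (a * b) ^ (1 / 2 : ℝ) = a ^ (1 / 2 : ℝ) * b ^ (1 / 2 : ℝ) :=
  ENNReal.mul_rpow_of_nonneg _ _ (by norm_num)

/-- `√3200 ≤ 57` in `ℝ≥0∞`. [folklore] -/
theorem y6_sqrt_3200_le : ENNReal.ofReal 3200 ^ (1 / 2 : ℝ) ≤ 57 := by
  have h : ENNReal.ofReal 3200 ≤ (57 : ℝ≥0∞) ^ 2 := by
    rw [show ((57 : ℝ≥0∞)) ^ 2 = ENNReal.ofReal (57 ^ 2) by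
      rw [ENNReal.ofReal_pow (by norm_num)]; norm_num]
    exact ENNReal.ofReal_le_ofReal (by norm_num)
  calc ENNReal.ofReal 3200 ^ (1 / 2 : ℝ) ≤ ((57 : ℝ≥0∞) ^ 2) ^ (1 / 2 : ℝ) := ENNReal.rpow_le_rpow h (by norm_num)
    _ = 57 := y6_sq_rpow_half _

end Algebra

/-! ### The one-sided Poincaré increment along a parent move -/

section Poincare

variable {ω : ℝ³ → ℝ³}

/-- Volume of a ball of radius `3ρ` in `ℝ³`: `vol B(y, 3ρ) = ofReal(27ρ³) · vol B(0,1)`. [folklore] -/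
theorem volume_ball_three_mul (y : ℝ³) {ρ : ℝ} (hρ : 0 ≤ ρ) :
    volume (ball y (3 * ρ)) = ENNReal.ofReal (27 * ρ ^ 3) * volume (ball (0 : ℝ³) 1) := by
  rw [Measure.addHaar_ball volume y (by positivity : (0:ℝ) ≤ 3 * ρ), finrank_euclideanSpace_fin]
  congr 1; congr 1; ring

/-- **Scale invariance of the normalisation**: `(ρ⁻³)^{1/2} (vol B(y,3ρ))^{1/2} = (27 vol B(0,1))^{1/2}`
for `ρ > 0` (so parent and child averages compare the same multiple of the mean). [folklore] -/
theorem rpow_half_mul_volume_ball_rpow_half (y : ℝ³) {ρ : ℝ} (hρ : 0 < ρ) :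
    ENNReal.ofReal (ρ⁻¹ ^ 3) ^ (1 / 2 : ℝ) * volume (ball y (3 * ρ)) ^ (1 / 2 : ℝ) =
      (ENNReal.ofReal 27 * volume (ball (0 : ℝ³) 1)) ^ (1 / 2 : ℝ) := by
  rw [← y6_mul_rpow_half, volume_ball_three_mul y hρ.le, ← mul_assoc,
    ← ENNReal.ofReal_mul (by positivity)]
  congr 2
  rw [show ρ⁻¹ ^ 3 * (27 * ρ ^ 3) = 27 by field_simp]

/-- **The Poincaré deviation on the container**: for `ω ∈ C¹` and `ρ > 0`,
`‖ω - ⨍_{B(y,10ρ)} ω‖_{L²(S)} ≤ (ofReal(3200 ρ²) ∫_{B(y,10ρ)} ‖Dω‖²)^{1/2}` for every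
`S ⊆ B(y, 10ρ)` (`PoincareBall.lintegral_ball_sub_average_sq_le`: `2³ · 4 (10ρ)² = 3200ρ²`). [cite: Tao2011, §10, proof of Thm. 10.1 ((10.22))] -/
theorem eLpNorm_sub_average_le_of_subset (hω : ContDiff ℝ 1 ω) (y : ℝ³) {ρ : ℝ} (hρ : 0 < ρ)
    {S : Set ℝ³} (hS : S ⊆ ball y (10 * ρ)) :
    eLpNorm (fun x => ω x - ⨍ v in ball y (10 * ρ), ω v) 2 (volume.restrict S) ≤
      (ENNReal.ofReal (3200 * ρ ^ 2) * ∫⁻ x in ball y (10 * ρ), ‖fderiv ℝ ω x‖ₑ ^ 2) ^ (1 / 2 : ℝ) := by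
  refine y6_le_rpow_half_of_sq_le ?_
  rw [eLpNorm_two_sq_eq_lintegral]
  have hP := PoincareBall.lintegral_ball_sub_average_sq_le (F := ℝ³) hω y (by positivity : (0:ℝ) < 10 * ρ)
  rw [finrank_euclideanSpace_fin] at hP
  calc ∫⁻ x in S, ‖ω x - ⨍ v in ball y (10 * ρ), ω v‖ₑ ^ 2
      ≤ ∫⁻ x in ball y (10 * ρ), ‖ω x - ⨍ v in ball y (10 * ρ), ω v‖ₑ ^ 2 := lintegral_mono_set hS
    _ ≤ 2 ^ 3 * ENNReal.ofReal (4 * (10 * ρ) ^ 2) * ∫⁻ x in ball y (10 * ρ), ‖fderiv ℝ ω x‖ₑ ^ 2 := hP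
    _ = ENNReal.ofReal (3200 * ρ ^ 2) * ∫⁻ x in ball y (10 * ρ), ‖fderiv ℝ ω x‖ₑ ^ 2 := by
        congr 1
        rw [show (2 : ℝ≥0∞) ^ 3 = ENNReal.ofReal 8 by norm_num, ← ENNReal.ofReal_mul (by norm_num)]
        congr 1; ring

/-- **The one-sided Poincaré increment along a parent move** (Tao's (10.22), in the form the
chain uses): for `ω ∈ C¹`, `ρ > 0`, and a parent point `z` with `ρ_z = λρ`, `|z - y| = 3ρ`:
`rmsE ω y ρ ≤ rmsE ω z ρ_z + 114 (dissE ω y ρ)^{1/2}`. [cite: Tao2011, §10, proof of Thm. 10.1 ((10.22))] -/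
theorem rmsE_le_rmsE_parent_add (hω : ContDiff ℝ 1 ω) {y z : ℝ³} {ρ ρz : ℝ} (hρ : 0 < ρ)
    (hρz : ρz = chainFactor * ρ) (hd : ‖z - y‖ = 3 * ρ) :
    rmsE ω y ρ ≤ rmsE ω z ρz + 114 * dissE ω y ρ ^ (1 / 2 : ℝ) := by
  have hρz0 : 0 < ρz := by rw [hρz]; exact mul_pos chainFactor_pos hρ
  have hρzρ : ρ ≤ ρz := by rw [hρz]; exact le_mul_of_one_le_left hρ.le one_le_chainFactor
  set B₁ : Set ℝ³ := ball y (3 * ρ) with hB₁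
  set B₂ : Set ℝ³ := ball z (3 * ρz) with hB₂
  set Bs : Set ℝ³ := ball y (10 * ρ) with hBs
  have h₁s : B₁ ⊆ Bs := ball_three_subset_ball_ten y hρ.le
  have h₂s : B₂ ⊆ Bs := ball_parent_subset hρz hd
  set m : ℝ³ := ⨍ v in Bs, ω v with hm
  set μ₁ : Measure ℝ³ := volume.restrict B₁ with hμ₁
  set μ₂ : Measure ℝ³ := volume.restrict B₂ with hμ₂
  -- Poincaré deviations on the two balls
  set P : ℝ≥0∞ := (ENNReal.ofReal (3200 * ρ ^ 2) * ∫⁻ x in Bs, ‖fderiv ℝ ω x‖ₑ ^ 2) ^ (1 / 2 : ℝ) with hP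
  have hE₁ : eLpNorm (fun x => ω x - m) 2 μ₁ ≤ P := eLpNorm_sub_average_le_of_subset hω y hρ h₁s
  have hE₂ : eLpNorm (fun x => ω x - m) 2 μ₂ ≤ P := eLpNorm_sub_average_le_of_subset hω y hρ h₂s
  -- measurability
  have hωm : ∀ μ : Measure ℝ³, AEStronglyMeasurable ω μ := fun μ => hω.continuous.aestronglyMeasurable
  have hcm : ∀ μ : Measure ℝ³, AEStronglyMeasurable (fun _ : ℝ³ => m) μ := fun μ => aestronglyMeasurable_const
  have hdm : ∀ μ : Measure ℝ³, AEStronglyMeasurable (fun x => ω x - m) μ := fun μ => (hωm μ).sub (hcm μ)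
  -- Minkowski on `B₁`: `‖ω‖ ≤ ‖ω - m‖ + ‖m‖`
  have hM₁ : eLpNorm ω 2 μ₁ ≤ eLpNorm (fun x => ω x - m) 2 μ₁ + eLpNorm (fun _ : ℝ³ => m) 2 μ₁ := by
    have h := eLpNorm_add_le (hdm μ₁) (hcm μ₁) (p := 2) (by norm_num)
    have e : ((fun x => ω x - m) + fun _ : ℝ³ => m) = ω := by funext x; simp
    rwa [e] at h
  -- Minkowski on `B₂`: `‖m‖ ≤ ‖ω - m‖ + ‖ω‖`
  have hM₂ : eLpNorm (fun _ : ℝ³ => m) 2 μ₂ ≤ eLpNorm (fun x => ω x - m) 2 μ₂ + eLpNorm ω 2 μ₂ := by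
    have h := eLpNorm_sub_le (hωm μ₂) (hdm μ₂) (p := 2) (by norm_num)
    have e : (ω - fun x => ω x - m) = fun _ : ℝ³ => m := by funext x; simp
    rw [e] at h
    calc eLpNorm (fun _ : ℝ³ => m) 2 μ₂ ≤ eLpNorm ω 2 μ₂ + eLpNorm (fun x => ω x - m) 2 μ₂ := h
      _ = _ := add_comm _ _
  -- the constant terms
  have htwo : (1 / ENNReal.toReal 2 : ℝ) = 1 / 2 := by norm_num
  have hc₁ : eLpNorm (fun _ : ℝ³ => m) 2 μ₁ = ‖m‖ₑ * volume B₁ ^ (1 / 2 : ℝ) := by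
    rw [eLpNorm_const' m (by norm_num) (by norm_num), htwo, hμ₁, Measure.restrict_apply_univ]
  have hc₂ : eLpNorm (fun _ : ℝ³ => m) 2 μ₂ = ‖m‖ₑ * volume B₂ ^ (1 / 2 : ℝ) := by
    rw [eLpNorm_const' m (by norm_num) (by norm_num), htwo, hμ₂, Measure.restrict_apply_univ]
  -- the normalising factors
  set cρ : ℝ≥0∞ := ENNReal.ofReal (ρ⁻¹ ^ 3) ^ (1 / 2 : ℝ) with hcρ
  set cρz : ℝ≥0∞ := ENNReal.ofReal (ρz⁻¹ ^ 3) ^ (1 / 2 : ℝ) with hcρz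
  have hK₁ : cρ * volume B₁ ^ (1 / 2 : ℝ) = (ENNReal.ofReal 27 * volume (ball (0 : ℝ³) 1)) ^ (1 / 2 : ℝ) :=
    rpow_half_mul_volume_ball_rpow_half y hρ
  have hK₂ : cρz * volume B₂ ^ (1 / 2 : ℝ) = (ENNReal.ofReal 27 * volume (ball (0 : ℝ³) 1)) ^ (1 / 2 : ℝ) :=
    rpow_half_mul_volume_ball_rpow_half z hρz0
  have hcmp : cρz ≤ cρ := by
    rw [hcρ, hcρz]
    refine ENNReal.rpow_le_rpow (ENNReal.ofReal_le_ofReal ?_) (by norm_num)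
    exact pow_le_pow_left₀ (inv_nonneg.2 hρz0.le) ((inv_le_inv₀ hρz0 hρ).2 hρzρ) 3
  -- `cρ P ≤ 57 dissE^{1/2}`
  have hcP : cρ * P ≤ 57 * dissE ω y ρ ^ (1 / 2 : ℝ) := by
    rw [hcρ, hP, ← y6_mul_rpow_half, ← mul_assoc, ← ENNReal.ofReal_mul (by positivity),
      show ρ⁻¹ ^ 3 * (3200 * ρ ^ 2) = 3200 * ρ⁻¹ by field_simp, ENNReal.ofReal_mul (by norm_num),
      mul_assoc, y6_mul_rpow_half, dissE_def]
    exact mul_le_mul' y6_sqrt_3200_le le_rfl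
  -- assemble
  have step1 : rmsE ω y ρ ≤ cρ * eLpNorm (fun x => ω x - m) 2 μ₁ + ‖m‖ₑ * (cρ * volume B₁ ^ (1 / 2 : ℝ)) := by
    rw [rmsE_def, ← hcρ, ← hμ₁]
    calc cρ * eLpNorm ω 2 μ₁ ≤ cρ * (eLpNorm (fun x => ω x - m) 2 μ₁ + eLpNorm (fun _ : ℝ³ => m) 2 μ₁) :=
          mul_le_mul' le_rfl hM₁
      _ = cρ * eLpNorm (fun x => ω x - m) 2 μ₁ + ‖m‖ₑ * (cρ * volume B₁ ^ (1 / 2 : ℝ)) := by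
          rw [mul_add, hc₁]; ring
  have step2 : ‖m‖ₑ * (cρz * volume B₂ ^ (1 / 2 : ℝ)) ≤ cρz * eLpNorm (fun x => ω x - m) 2 μ₂ + rmsE ω z ρz := by
    rw [rmsE_def, ← hcρz, ← hμ₂]
    calc ‖m‖ₑ * (cρz * volume B₂ ^ (1 / 2 : ℝ)) = cρz * eLpNorm (fun _ : ℝ³ => m) 2 μ₂ := by
          rw [hc₂]; ring
      _ ≤ cρz * (eLpNorm (fun x => ω x - m) 2 μ₂ + eLpNorm ω 2 μ₂) := mul_le_mul' le_rfl hM₂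
      _ = cρz * eLpNorm (fun x => ω x - m) 2 μ₂ + cρz * eLpNorm ω 2 μ₂ := mul_add _ _ _
  calc rmsE ω y ρ ≤ cρ * eLpNorm (fun x => ω x - m) 2 μ₁ + ‖m‖ₑ * (cρ * volume B₁ ^ (1 / 2 : ℝ)) := step1
    _ = cρ * eLpNorm (fun x => ω x - m) 2 μ₁ + ‖m‖ₑ * (cρz * volume B₂ ^ (1 / 2 : ℝ)) := by rw [hK₁, hK₂]
    _ ≤ cρ * eLpNorm (fun x => ω x - m) 2 μ₁ + (cρz * eLpNorm (fun x => ω x - m) 2 μ₂ + rmsE ω z ρz) := by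
        gcongr
    _ ≤ cρ * P + (cρ * P + rmsE ω z ρz) :=
        add_le_add (mul_le_mul' le_rfl hE₁) (add_le_add (mul_le_mul' hcmp hE₂) le_rfl)
    _ = rmsE ω z ρz + 2 * (cρ * P) := by ring
    _ ≤ rmsE ω z ρz + 2 * (57 * dissE ω y ρ ^ (1 / 2 : ℝ)) := by gcongr
    _ = rmsE ω z ρz + 114 * dissE ω y ρ ^ (1 / 2 : ℝ) := by ring

end Poincare

/-! ### (10.23): the local bound from the localised enstrophy -/

section Bong

variable {x₀ : ℝ³} {a b k : ℝ}

/-- `(ofReal (x²))^{1/2} = ofReal x` for `x ≥ 0`. [folklore] -/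
theorem y6_ofReal_sq_rpow_half {x : ℝ} (hx : 0 ≤ x) :
    ENNReal.ofReal (x ^ 2) ^ (1 / 2 : ℝ) = ENNReal.ofReal x := by
  rw [ENNReal.ofReal_pow hx, y6_sq_rpow_half]

/-- **Tao's (10.23) for the continuous family**: on the open annulus,
`rmsE ω y ρ(y) ≤ √(2W/(97k)) ρ(y)⁻²`, `W = ½∫|ω|²η` the localised enstrophy
(`∫_{B(y,3ρ(y))}|ω|² ≤ 2W/(0.97 η(y))` and `η(y) = 100kρ(y)`). [cite: Tao2011, §10, proof of Thm. 10.1 ((10.23))] -/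
theorem rmsE_whitney_le (hk : 0 < k) {u : ℝ³ → ℝ³} (hω : Continuous (curl u)) {y : ℝ³}
    (hy : 0 < annDepth x₀ a b y) :
    rmsE (curl u) y (whitneyRadius x₀ a b k y) ≤
      ENNReal.ofReal (Real.sqrt (2 * localisedEnstrophy (fun x => annularRamp k a b ‖x - x₀‖) u / (97 * k)) *
        (whitneyRadius x₀ a b k y)⁻¹ ^ 2) := by
  set ρ := whitneyRadius x₀ a b k y with hρdef
  set W := localisedEnstrophy (fun x => annularRamp k a b ‖x - x₀‖) u with hW
  have hρ : 0 < ρ := whitneyRadius_pos hk hy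
  have hW0 : 0 ≤ W := localisedEnstrophy_nonneg (fun x => annularRamp_nonneg _ _ _ _) u
  have hη : annularRamp k a b ‖y - x₀‖ = 100 * k * ρ := annularRamp_eq_mul_whitneyRadius hk hy.le
  -- the real bound on the ball
  have hreal : ∫ z in ball y (3 * ρ), ‖curl u z‖ ^ 2 ≤ 2 * W / (97 * k * ρ) := by
    have h := setIntegral_curl_sq_whitneyBall_le (x₀ := x₀) (a := a) (b := b) hk (c := 3) (by norm_num) hy hω
    rw [← hρdef, hη, ← hW] at h
    refine h.trans (le_of_eq ?_)
    congr 1; ring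
  -- in `ℝ≥0∞`
  have hsq : rmsE (curl u) y ρ ^ 2 ≤ ENNReal.ofReal ((Real.sqrt (2 * W / (97 * k)) * ρ⁻¹ ^ 2) ^ 2) := by
    rw [rmsE_sq, ← eLpNorm_two_sq_eq_lintegral, ← ofReal_setIntegral_norm_sq_eq_eLpNorm_sq hω,
      ← ENNReal.ofReal_mul (by positivity)]
    refine ENNReal.ofReal_le_ofReal ?_
    calc ρ⁻¹ ^ 3 * ∫ z in ball y (3 * ρ), ‖curl u z‖ ^ 2 ≤ ρ⁻¹ ^ 3 * (2 * W / (97 * k * ρ)) :=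
          mul_le_mul_of_nonneg_left hreal (by positivity)
      _ = (Real.sqrt (2 * W / (97 * k)) * ρ⁻¹ ^ 2) ^ 2 := by
          rw [mul_pow, Real.sq_sqrt (by positivity)]
          field_simp
  calc rmsE (curl u) y ρ ≤ (ENNReal.ofReal ((Real.sqrt (2 * W / (97 * k)) * ρ⁻¹ ^ 2) ^ 2)) ^ (1 / 2 : ℝ) :=
        y6_le_rpow_half_of_sq_le hsq
    _ = _ := y6_ofReal_sq_rpow_half (by positivity)

end Bong

/-! ### Measurability in the centre of integrals over moving balls -/

section Measurability

/-- For a measurable `g ≥ 0` and a continuous radius function `R`, the map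
`y ↦ ∫_{B(y, R(y))} g` is measurable (Tonelli for the indicator of the open set
`{(y, z) : |z - y| < R(y)}`). [folklore] -/
theorem measurable_setLIntegral_ball_var {g : ℝ³ → ℝ≥0∞} (hg : Measurable g) {R : ℝ³ → ℝ}
    (hR : Continuous R) : Measurable fun y => ∫⁻ z in ball y (R y), g z := by
  have hS : MeasurableSet {p : ℝ³ × ℝ³ | dist p.2 p.1 < R p.1} :=
    (isOpen_lt (continuous_snd.dist continuous_fst) (hR.comp continuous_fst)).measurableSet
  have hF : Measurable fun p : ℝ³ × ℝ³ => {p : ℝ³ × ℝ³ | dist p.2 p.1 < R p.1}.indicator (fun p => g p.2) p :=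
    (hg.comp measurable_snd).indicator hS
  have e : (fun y => ∫⁻ z in ball y (R y), g z) =
      fun y => ∫⁻ z, {p : ℝ³ × ℝ³ | dist p.2 p.1 < R p.1}.indicator (fun p => g p.2) (y, z) := by
    funext y
    rw [← lintegral_indicator measurableSet_ball]
    refine lintegral_congr fun z => ?_
    by_cases hz : z ∈ ball y (R y)
    · rw [indicator_of_mem hz, indicator_of_mem (by simpa [mem_ball] using hz)]
    · rw [indicator_of_notMem hz, indicator_of_notMem (by simpa [mem_ball] using hz)]
  rw [e]
  exact hF.lintegral_prod_right'

/-- Measurability of `y ↦ rmsE ω y (R y)` for continuous `ω` and a continuous radius function.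
[folklore] -/
theorem measurable_rmsE_var {ω : ℝ³ → ℝ³} (hω : Continuous ω) {R : ℝ³ → ℝ} (hR : Continuous R) :
    Measurable fun y => rmsE ω y (R y) := by
  have h1 : Measurable fun y => ENNReal.ofReal ((R y)⁻¹ ^ 3) ^ (1 / 2 : ℝ) :=
    ((hR.measurable.inv.pow_const 3).ennreal_ofReal).pow_const _
  have h2 : Measurable fun y => ∫⁻ z in ball y (3 * R y), ‖ω z‖ₑ ^ 2 :=
    measurable_setLIntegral_ball_var (hω.enorm.measurable.pow_const 2) (continuous_const.mul hR)
  have e : (fun y => rmsE ω y (R y)) =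
      fun y => ENNReal.ofReal ((R y)⁻¹ ^ 3) ^ (1 / 2 : ℝ) * (∫⁻ z in ball y (3 * R y), ‖ω z‖ₑ ^ 2) ^ (1 / 2 : ℝ) := by
    funext y
    rw [rmsE_def, eLpNorm_eq_lintegral_rpow_enorm_toReal (by norm_num) (by norm_num), ENNReal.toReal_ofNat]
    congr 2
    refine lintegral_congr fun z => ?_
    rw [ENNReal.rpow_two]
  rw [e]
  exact h1.mul (h2.pow_const _)

/-- Measurability of `y ↦ dissE ω y (R y)` for `ω ∈ C¹` and a continuous radius function. [folklore] -/
theorem measurable_dissE_var {ω : ℝ³ → ℝ³} (hω : ContDiff ℝ 1 ω) {R : ℝ³ → ℝ} (hR : Continuous R) :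
    Measurable fun y => dissE ω y (R y) := by
  have h1 : Measurable fun y => ENNReal.ofReal (R y)⁻¹ := hR.measurable.inv.ennreal_ofReal
  have h2 : Measurable fun y => ∫⁻ z in ball y (10 * R y), ‖fderiv ℝ ω z‖ₑ ^ 2 :=
    measurable_setLIntegral_ball_var ((hω.continuous_fderiv one_ne_zero).enorm.measurable.pow_const 2)
      (continuous_const.mul hR)
  exact h1.mul h2

end Measurability

end Literature.Analysis.FluidPDE

end
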